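import Summits.BirchSwinnertonDyer.BirchSwinnertonDyer.Theorems.ManinLocalTwoThreeParamPoleJTwist
import Literature.NumberTheory.EllipticCurves.ModularParamXRationality
import Literature.NumberTheory.EllipticCurves.CuspFormsGamma0IntegralBasisProofs
import Literature.NumberTheory.EllipticCurves.RealLatticePeriod
import Literature.NumberTheory.EllipticCurves.ModularCurve
import Literature.FieldTheory.AlgClosed.AutomorphismExtension
import HarnessLib

/-!
# `j` is algebraic at the poles of the modular parametrisation

Cell `bsd-f2-manin`, prover seat p3 (gen 16), crux C3 `ManinPrimeToThreeAtNine` (stmt-22968; also C2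
stmt-22967): the ALGEBRAICITY INPUT of the modular-form witness stub of line `kato_shift_three` v23
(`stub_kummerCubeRootModularFormWitness`, MEMO-an §80.12 step (6); flagged by p2 g17, STATUS
2026-08-29T14:47Z: «needs "`j(P)` is ALGEBRAIC for `P ∈ φ⁻¹(E[2])`"») — here as a THEOREM of the
tree, with no named fact:

* `isIntegral_kleinJ_of_eichlerIntegral_mem_lattice` — for `f ∈ S₂(Γ₀(N))`, `f ≠ 0`, with rational
  Fourier coefficients, a lattice `Λ(L) ⊇ Λ_f` with `g₂(L), g₃(L) ∈ ℚ`, and a pole `τ₁ ∈ ℍ` of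
  `x = ℘_Λ(2πi∫f)` (`u(τ₁) ∈ Λ`): **`j(τ₁)` is algebraic** (`IsIntegral ℚ (kleinJ τ₁)`).
* `isIntegral_kleinJ_of_smul_eichlerIntegral_mem` — the same for a modular parametrisation datum
  `D : ModularParametrizationData W N` of a curve `W/ℚ`: every `τ₁ ∈ ℍ` with `φ_D(τ₁) = O`
  (`c·u(τ₁) ∈ Λ_W`) has algebraic `j(τ₁)`.

Proof (Shimura's `Aut(ℂ)`-argument, assembled from tree theorems).  Present `x·G = F` with the
EXPLICIT level-one annihilator `G = Δ^a∏_{s∈S}(E₄³Δ(s) − E₄(s)³Δ)^{n(s)}` (`exists_explicit_presentation`).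
For `σ ∈ Aut(ℂ)`: `σ(F̂)·Ĝ = σ(Ĝ)·F̂` on `q`-expansions (tree `map_qExpansion_mul_eq`, as `g₂, g₃ ∈ ℚ`);
`σ(F̂)` is the expansion of a cusp form `F^σ` (tree `exists_conj_cuspForm_gamma0`, Shimura Thm. 3.52)
and `σ(Ĝ)` that of the TWISTED annihilator `G^σ = Δ^a∏(E₄³σ(Δ(s)) − σ(E₄(s)³)Δ)^{n(s)}`
(`map_qExpansion_twistFun`); hence `F^σ·G = G^σ·F` on `ℍ`.  At a pole `τ₁`, if `G^σ(τ₁) ≠ 0` then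
`x = F^σ/G^σ` near `τ₁` would be holomorphic at `τ₁` — but `x` has a pole there
(`meromorphicOrderAt_weierstrassP_eichlerIntegral`).  So `G^σ(τ₁) = 0`, i.e. `j(τ₁) = σ(j(s))` for some
`s ∈ S`; thus the `Aut(ℂ)`-orbit of `j(τ₁)` lies in the finite set `j(S)` and `j(τ₁)` is algebraic
(tree `Complex.isIntegral_of_forall_ringEquiv_mem`).  BSD is not proved by this; C2/C3 are not proved.
-/

set_option linter.dupNamespace false

noncomputable section

open Complex Filter Topology Set Function
open UpperHalfPlane hiding I
open scoped Real Topology Manifold MatrixGroups PeriodPair ModularForm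
open ModularForm EisensteinSeries SlashInvariantForm ModularFormClass CongruenceSubgroup PowerSeries
open Literature.NumberTheory.EllipticCurves Literature.NumberTheory.EllipticCurves.ModularForms

namespace Summit.BirchSwinnertonDyer.BirchSwinnertonDyer.Theorems.ManinLocalTwoThree.ParamPoleJ

variable {N : ℕ} [NeZero N]

/-! ### A cusp form on `Γ₀(N)` is analytic on the half-plane and not locally zero unless zero -/

omit [NeZero N] in
/-- `F ∘ ofComplex` is analytic on `{im > 0}` for a cusp form `F`. [folklore] -/
theorem analyticOnNhd_cuspForm_comp_ofComplex {k : ℤ} (F : CuspForm (Gamma0 N) k) :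
    AnalyticOnNhd ℂ (⇑F ∘ ofComplex) {z : ℂ | 0 < z.im} :=
  (UpperHalfPlane.mdifferentiable_iff.mp F.holo').analyticOnNhd isOpen_upperHalfPlaneSet

omit [NeZero N] in
/-- A nonzero cusp form is eventually nonzero on punctured neighbourhoods (identity theorem on the
connected half-plane). [folklore] -/
theorem eventually_ne_zero_of_cuspForm_ne_zero {k : ℤ} (G : CuspForm (Gamma0 N) k) (hG : G ≠ 0)
    {z₁ : ℂ} (hz₁ : 0 < z₁.im) : ∀ᶠ w in 𝓝[≠] z₁, (⇑G ∘ ofComplex) w ≠ 0 := by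
  rcases (analyticOnNhd_cuspForm_comp_ofComplex G z₁ hz₁).eventually_eq_zero_or_eventually_ne_zero
    with h | h
  · exfalso
    apply hG
    have hEq := (analyticOnNhd_cuspForm_comp_ofComplex G).eqOn_zero_of_preconnected_of_eventuallyEq_zero
      convex_setOf_im_pos.isPreconnected hz₁ h
    apply DFunLike.ext
    intro τ
    have := hEq (show 0 < (τ : ℂ).im from τ.im_pos)
    simpa [comp_apply, ofComplex_apply] using this
  · exact h

/-! ### The key step: the twisted annihilator vanishes at every pole -/

/-- **At a pole of `x = ℘_Λ(2πi∫f)` the `σ`-twisted annihilator vanishes.**  With an explicit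
presentation `x·G = F`, `G = Δ^a∏(E₄³Δ(s) − E₄(s)³Δ)^{n(s)}`, rational `f`, `σ(g₂) = g₂`, `σ(g₃) = g₃`:
`G^σ(τ₁) = 0` for `G^σ = Δ^a∏(E₄³σ(Δ(s)) − σ(E₄(s)³)Δ)^{n(s)}` whenever `u(τ₁) ∈ Λ`.
[cite: ShimuraIATAF1971, §6.2 Prop. 6.9 and Thm. 7.14] -/
theorem twistFun_conj_apply_eq_zero_of_pole (f : CuspForm (Gamma0 N) 2) (hf : f ≠ 0)
    (hrat : ∀ m, ∃ q : ℚ, (q : ℂ) = cuspCoeff f m) (L : PeriodPair)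
    {S : Finset ℍ} {n : ℍ → ℕ} {a : ℕ} (ha : 1 ≤ a)
    {F : CuspForm (Gamma0 N) ((12 * (a + ∑ s ∈ S, n s) : ℕ) : ℤ)}
    (hpres : IsXPresentation f L F
      (twistCuspForm S n a (fun s ↦ ModularForm.discriminant s) (fun s ↦ E₄ s ^ 3) N ha))
    (σ : ℂ ≃+* ℂ) (hg₂ : σ L.g₂ = L.g₂) (hg₃ : σ L.g₃ = L.g₃)
    {τ₁ : ℍ} (hτ₁ : eichlerIntegral f τ₁ ∈ L.lattice) :
    twistFun S n a (fun s ↦ σ (ModularForm.discriminant s)) (fun s ↦ σ (E₄ s ^ 3)) τ₁ = 0 := by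
  classical
  set G := twistCuspForm S n a (fun s ↦ ModularForm.discriminant s) (fun s ↦ E₄ s ^ 3) N ha with hGdef
  set Gσ := twistCuspForm S n a (fun s ↦ σ (ModularForm.discriminant s)) (fun s ↦ σ (E₄ s ^ 3)) N ha
    with hGσdef
  have hK2 : (2 : ℤ) ≤ ((12 * (a + ∑ s ∈ S, n s) : ℕ) : ℤ) := by
    have h12 : 2 ≤ 12 * (a + ∑ s ∈ S, n s) := by omega
    exact_mod_cast h12
  -- the conjugate of `F` and the `q`-expansion identity `F^σ·G = G^σ·F`
  obtain ⟨Fσ, hFσ⟩ := exists_conj_cuspForm_gamma0 hK2 (σ : ℂ →+* ℂ) F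
  have hqFσ : qExpansion 1 ⇑Fσ = (qExpansion 1 ⇑F).map (σ : ℂ →+* ℂ) := by
    ext m
    rw [coeff_map]
    exact hFσ m
  have hqGσ : (qExpansion 1 ⇑G).map (σ : ℂ →+* ℂ) = qExpansion 1 ⇑Gσ :=
    map_qExpansion_twistFun (σ : ℂ →+* ℂ) S n a _ _
  have hmul := hpres.map_qExpansion_mul_eq hf hrat σ hg₂ hg₃
  rw [← hqFσ, hqGσ] at hmul
  -- as modular forms of weight `2K`
  have hforms : ((Fσ : ModularForm (Gamma0 N) ((12 * (a + ∑ s ∈ S, n s) : ℕ) : ℤ)).mul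
      (G : ModularForm (Gamma0 N) ((12 * (a + ∑ s ∈ S, n s) : ℕ) : ℤ))) =
      ((Gσ : ModularForm (Gamma0 N) ((12 * (a + ∑ s ∈ S, n s) : ℕ) : ℤ)).mul
      (F : ModularForm (Gamma0 N) ((12 * (a + ∑ s ∈ S, n s) : ℕ) : ℤ))) := by
    rw [← sub_eq_zero, ← qExpansionL_eq_zero_iff, ← neg_add_eq_sub, qExpansionL_add, qExpansionL_neg,
      qExpansionL_mul, qExpansionL_mul, neg_add_eq_sub, sub_eq_zero, qExpansionL_def, qExpansionL_def,
      qExpansionL_def, qExpansionL_def]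
    change (((qExpansion 1 ⇑Fσ : ℂ⟦X⟧)) : LaurentSeries ℂ) * ((qExpansion 1 ⇑G : ℂ⟦X⟧) : LaurentSeries ℂ) =
      ((qExpansion 1 ⇑Gσ : ℂ⟦X⟧) : LaurentSeries ℂ) * ((qExpansion 1 ⇑F : ℂ⟦X⟧) : LaurentSeries ℂ)
    rw [← PowerSeries.coe_mul, ← PowerSeries.coe_mul, hmul]
  have hpt : ∀ τ : ℍ, Fσ τ * G τ = Gσ τ * F τ := fun τ ↦ by
    have := congrArg (fun H ↦ (⇑H) τ) hforms
    exact this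
  -- the pole
  set z₁ : ℂ := (τ₁ : ℂ) with hz₁def
  have hz₁ : 0 < z₁.im := τ₁.im_pos
  set U : ℂ → ℂ := fun w ↦ eichlerIntegral f (ofComplex w) with hU
  set X : ℂ → ℂ := fun w ↦ ℘[L] (eichlerIntegral f (ofComplex w)) with hX
  have hUz₁ : U z₁ ∈ L.lattice := by simpa [hU, hz₁def, ofComplex_apply] using hτ₁
  -- `x` has negative order at `z₁`
  have hXord := meromorphicOrderAt_weierstrassP_eichlerIntegral f hf L hz₁ hUz₁
  have hm : analyticOrderNatAt (fun w : ℂ ↦ eichlerIntegral f (ofComplex w) -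
      eichlerIntegral f (ofComplex z₁)) z₁ ≠ 0 := by
    have hg : AnalyticAt ℂ (fun w : ℂ ↦ eichlerIntegral f (ofComplex w) -
        eichlerIntegral f (ofComplex z₁)) z₁ :=
      (analyticAt_eichlerIntegral_comp_ofComplex f hz₁).sub analyticAt_const
    have hne0 := hg.analyticOrderAt_ne_zero.mpr (sub_self _)
    have hnetop := analyticOrderAt_eichlerIntegral_sub_ne_top f hf hz₁
    intro h0
    apply hne0
    rw [← Nat.cast_analyticOrderNatAt hnetop, h0, Nat.cast_zero]
  have hXneg : meromorphicOrderAt X z₁ < 0 := by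
    rw [hX, hXord]
    have : ((-2 : ℤ) * (analyticOrderNatAt (fun w : ℂ ↦ eichlerIntegral f (ofComplex w) -
        eichlerIntegral f (ofComplex z₁)) z₁ : ℕ)) < 0 := by omega
    exact_mod_cast this
  -- suppose `G^σ(τ₁) ≠ 0`
  by_contra h0
  have h0' : (⇑Gσ ∘ ofComplex) z₁ ≠ 0 := by
    rw [comp_apply, hz₁def, ofComplex_apply]
    exact h0
  -- near `z₁`, off `z₁`: no poles, `G ≠ 0`, `G^σ ≠ 0`
  have hev₁ : ∀ᶠ w in 𝓝[≠] z₁, 0 < w.im :=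
    nhdsWithin_le_nhds (isOpen_upperHalfPlaneSet.mem_nhds hz₁)
  have hev₂ : ∀ᶠ w in 𝓝[≠] z₁, U w ∉ L.lattice := by
    obtain ⟨V, hV, hVimp⟩ := exists_nhds_forall_eichlerIntegral_mem_imp_eq f hf L τ₁
    have hVz : ((↑) : ℍ → ℂ) '' V ∈ 𝓝 z₁ := isOpenEmbedding_coe.image_mem_nhds.mpr hV
    filter_upwards [nhdsWithin_le_nhds hVz, self_mem_nhdsWithin] with w hw hne
    obtain ⟨τ, hτV, rfl⟩ := hw
    intro hmem
    apply hne
    have : τ = τ₁ := hVimp τ hτV (by simpa [hU, ofComplex_apply] using hmem)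
    rw [this, hz₁def]
    exact Set.mem_singleton _
  have hev₃ : ∀ᶠ w in 𝓝[≠] z₁, (⇑G ∘ ofComplex) w ≠ 0 :=
    eventually_ne_zero_of_cuspForm_ne_zero G hpres.1 hz₁
  have hev₄ : ∀ᶠ w in 𝓝[≠] z₁, (⇑Gσ ∘ ofComplex) w ≠ 0 :=
    nhdsWithin_le_nhds (((analyticOnNhd_cuspForm_comp_ofComplex Gσ z₁ hz₁).continuousAt).eventually_ne h0')
  -- there `x = F^σ/G^σ`
  set Y : ℂ → ℂ := fun w ↦ (⇑Fσ ∘ ofComplex) w / (⇑Gσ ∘ ofComplex) w with hY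
  have hXY : X =ᶠ[𝓝[≠] z₁] Y := by
    filter_upwards [hev₂, hev₃, hev₄] with w h2 h3 h4
    have hF := hpres.2 (ofComplex w) h2
    have hp := hpt (ofComplex w)
    simp only [comp_apply] at h3 h4
    rw [hY, hX]
    simp only [comp_apply]
    rw [eq_div_iff h4]
    have h5 : (Fσ (ofComplex w) - Gσ (ofComplex w) * ℘[L] (eichlerIntegral f (ofComplex w))) *
        G (ofComplex w) = 0 := by
      rw [sub_mul, mul_assoc, hF, hp, sub_self]
    have h6 := (mul_eq_zero.mp h5).resolve_right h3
    linear_combination -h6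
  have hYan : AnalyticAt ℂ Y z₁ :=
    (analyticOnNhd_cuspForm_comp_ofComplex Fσ z₁ hz₁).div
      (analyticOnNhd_cuspForm_comp_ofComplex Gσ z₁ hz₁) h0'
  have := hYan.meromorphicOrderAt_nonneg
  rw [← meromorphicOrderAt_congr hXY] at this
  exact absurd hXneg (not_lt.mpr this)

/-- **Hence `j(τ₁) = σ(j(s))` for some `s ∈ S`** (`Δ` has no zeros on `ℍ`, `j = E₄³/Δ`).
[cite: ShimuraIATAF1971, §6.2 Prop. 6.9] -/
theorem exists_kleinJ_eq_conj_of_pole (f : CuspForm (Gamma0 N) 2) (hf : f ≠ 0)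
    (hrat : ∀ m, ∃ q : ℚ, (q : ℂ) = cuspCoeff f m) (L : PeriodPair)
    {S : Finset ℍ} {n : ℍ → ℕ} {a : ℕ} (ha : 1 ≤ a)
    {F : CuspForm (Gamma0 N) ((12 * (a + ∑ s ∈ S, n s) : ℕ) : ℤ)}
    (hpres : IsXPresentation f L F
      (twistCuspForm S n a (fun s ↦ ModularForm.discriminant s) (fun s ↦ E₄ s ^ 3) N ha))
    (σ : ℂ ≃+* ℂ) (hg₂ : σ L.g₂ = L.g₂) (hg₃ : σ L.g₃ = L.g₃)
    {τ₁ : ℍ} (hτ₁ : eichlerIntegral f τ₁ ∈ L.lattice) :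
    ∃ s ∈ S, kleinJ τ₁ = σ (kleinJ s) := by
  have h := twistFun_conj_apply_eq_zero_of_pole f hf hrat L ha hpres σ hg₂ hg₃ hτ₁
  rw [twistFun, mul_eq_zero] at h
  rcases h with h | h
  · exact absurd (pow_eq_zero_iff'.mp h).1 (ModularForm.discriminant_ne_zero τ₁)
  · obtain ⟨s, hs, hzero⟩ := Finset.prod_eq_zero_iff.mp h
    refine ⟨s, hs, ?_⟩
    have hbase := (pow_eq_zero_iff'.mp hzero).1
    have hΔ₁ := ModularForm.discriminant_ne_zero τ₁
    have hΔs : σ (ModularForm.discriminant s) ≠ 0 :=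
      (map_ne_zero σ).mpr (ModularForm.discriminant_ne_zero s)
    rw [kleinJ, kleinJ, map_div₀, div_eq_div_iff hΔ₁ hΔs]
    linear_combination hbase

/-! ### The theorem -/

/-- **`j` is algebraic at every pole of `x = ℘_Λ(2πi∫f)`.**  Let `f ∈ S₂(Γ₀(N))`, `f ≠ 0`, have
rational Fourier coefficients, let `Λ(L) ⊇ Λ_f` be a lattice with rational invariants `g₂(L), g₃(L)`,
and let `τ₁ ∈ ℍ` with `u(τ₁) = 2πi∫_{i∞}^{τ₁} f ∈ Λ` (a pole of the `x`-coordinate `℘_Λ(u)` of the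
analytic modular parametrisation `X₀(N) → ℂ/Λ`).  Then `j(τ₁)` is an algebraic number.  (Classically:
`φ` is a morphism of curves over `ℚ`, so `φ⁻¹(O)` consists of algebraic points of `X₀(N)`.)
[cite: ShimuraIATAF1971, §6.2 Prop. 6.9 and Thm. 7.14] -/
theorem isIntegral_kleinJ_of_eichlerIntegral_mem_lattice (f : CuspForm (Gamma0 N) 2) (hf : f ≠ 0)
    (hrat : ∀ m, ∃ q : ℚ, (q : ℂ) = cuspCoeff f m) (L : PeriodPair)
    (hΛ : ∀ x ∈ periodLattice f, x ∈ L.lattice)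
    (hg₂ : ∃ q : ℚ, (q : ℂ) = L.g₂) (hg₃ : ∃ q : ℚ, (q : ℂ) = L.g₃)
    {τ₁ : ℍ} (hτ₁ : eichlerIntegral f τ₁ ∈ L.lattice) : IsIntegral ℚ (kleinJ τ₁) := by
  classical
  obtain ⟨S, n, a, ha, F, -, -, hpres⟩ := exists_explicit_presentation f hf L hΛ
  obtain ⟨q₂, hq₂⟩ := hg₂
  obtain ⟨q₃, hq₃⟩ := hg₃
  refine Literature.FieldTheory.AlgClosed.Complex.isIntegral_of_forall_ringEquiv_mem
    (S := ((S.image kleinJ : Finset ℂ) : Set ℂ))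
    (Finset.finite_toSet _) fun σ ↦ ?_
  have hσ₂ : σ.symm L.g₂ = L.g₂ := by rw [← hq₂, map_ratCast]
  have hσ₃ : σ.symm L.g₃ = L.g₃ := by rw [← hq₃, map_ratCast]
  obtain ⟨s, hs, hj⟩ := exists_kleinJ_eq_conj_of_pole f hf hrat L ha hpres σ.symm hσ₂ hσ₃ hτ₁
  rw [Finset.coe_image]
  exact ⟨s, hs, by rw [hj, RingEquiv.apply_symm_apply]⟩

/-! ### For a modular parametrisation datum of a curve over `ℚ` -/

/-- **`j(τ₁)` is algebraic at every point `τ₁ ∈ ℍ` over the origin of a modular parametrisation**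
`φ_D : X₀(N) → W(ℂ)` of an elliptic curve `W/ℚ` (`D : ModularParametrizationData W N`, `c ≠ 0`):
if `c·2πi∫_{i∞}^{τ₁} f ∈ Λ_W` then `j(τ₁) ∈ ℚ̄`.  (The lattice `c⁻¹Λ_W ⊇ Λ_f` has invariants
`c⁴·c₄/12, c⁶·c₆/216 ∈ ℚ` and `f` has integer coefficients `aₙ(W)`.)  This is the algebraicity input
of the modular-form witness of the UDC line (C3 v23): the poles in `ℍ` of `W_u(c·E_f)` / of `ρ⁻¹h`
have algebraic `j`-values.  [cite: ShimuraIATAF1971, Thm. 7.14] -/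
theorem isIntegral_kleinJ_of_smul_eichlerIntegral_mem {W : WeierstrassCurve ℚ} [W.IsElliptic]
    (D : ModularParametrizationData W N) (hc : D.c ≠ 0) {τ₁ : ℍ}
    (hτ₁ : (D.c : ℂ) * eichlerIntegral D.f τ₁ ∈ D.L.lattice) : IsIntegral ℚ (kleinJ τ₁) := by
  have hc' : ((D.c : ℂ))⁻¹ ≠ 0 := inv_ne_zero (Int.cast_ne_zero.mpr hc)
  set L' : PeriodPair := D.L.mulLeft ((D.c : ℂ))⁻¹ hc' with hL'
  have hmem : ∀ x : ℂ, x ∈ L'.lattice ↔ (D.c : ℂ) * x ∈ D.L.lattice := fun x ↦ by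
    rw [hL', PeriodPair.mem_mulLeft_lattice, inv_inv]
  have hΛ : ∀ x ∈ periodLattice D.f, x ∈ L'.lattice := fun x hx ↦
    (hmem x).mpr (D.smul_periodLattice_le x hx)
  have hf : D.f ≠ 0 := D.isNewformOf.1.ne_zero
  have hrat : ∀ m, ∃ q : ℚ, (q : ℂ) = cuspCoeff D.f m := fun m ↦
    ⟨W.LFunction m, by rw [D.isNewformOf.2 m]; push_cast; rfl⟩
  have hg₂ : ∃ q : ℚ, (q : ℂ) = L'.g₂ := by
    refine ⟨(D.c : ℚ) ^ 4 * (W.c₄ / 12), ?_⟩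
    rw [hL', PeriodPair.g₂_mulLeft, D.isNeronLattice.1, inv_pow, inv_inv, WeierstrassCurve.baseChange,
      WeierstrassCurve.map_c₄, eq_ratCast]
    push_cast
    ring
  have hg₃ : ∃ q : ℚ, (q : ℂ) = L'.g₃ := by
    refine ⟨(D.c : ℚ) ^ 6 * (W.c₆ / 216), ?_⟩
    rw [hL', PeriodPair.g₃_mulLeft, D.isNeronLattice.2, inv_pow, inv_inv, WeierstrassCurve.baseChange,
      WeierstrassCurve.map_c₆, eq_ratCast]
    push_cast
    ring
  exact isIntegral_kleinJ_of_eichlerIntegral_mem_lattice D.f hf hrat L' hΛ hg₂ hg₃ ((hmem _).mpr hτ₁)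

end Summit.BirchSwinnertonDyer.BirchSwinnertonDyer.Theorems.ManinLocalTwoThree.ParamPoleJ

end
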